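/-
Copyright (c) 2026 the pub-hodgecm-mathlib formalisation cell (harness21).  Prover seat hodgecm-mathlib-K2E1-p08 (g4), Track B ∕ K2-LIT, h413 =
`stmt-HodgeConjecture-24833`, line `K2_E1_TraceFormulaBeta`, campaign «EIS-RANK-ONE» rung R4a at `N = 3`: continuity in `g`, joint continuity and HOLOMORPHY in `z` of the Borel
Eisenstein series of `U(2,1)` over a CM field on Godement's half-plane — ★ R2 (this seat) fed into ★ p09's regularity kit.
-/
import Summits.HodgeConjecture.HodgeConjecture.Theorems.K2E1BorelEisensteinGodementCMThree   -- ★ p857478 (this seat): Godement for `U(J₃)` over a CM field, unconditional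
import Summits.HodgeConjecture.HodgeConjecture.Theorems.K2E1EisensteinSeriesRegularity      -- ★ (K2E1-p09 (g4)): series with locally uniform summable majorants
import Mathlib.Analysis.SpecialFunctions.Pow.Deriv
import HarnessLib

/-!
# K2·E1 — `K2E1BorelEisensteinRegularCMThree`: THE BOREL EISENSTEIN SERIES `E(φ, z)(g) = Σ_q φ(γ̃_q g)·H(γ̃_q g)^z` OF `U(2,1)` OVER A CM FIELD IS CONTINUOUS IN `g`, JOINTLY
# CONTINUOUS IN `(z, g)` AND HOLOMORPHIC IN `z` ON GODEMENT'S HALF-PLANE `Re z > 2` — UNCONDITIONAL (campaign EIS-RANK-ONE, rung R4a at `N = 3`)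

Track B ∕ K2-LIT, crux h413 = `stmt-HodgeConjecture-24833`, route of record `HCCMUnconditional`; cell `hodgecm-mathlib`, squad K2, ENGINE E1.  Prover seat
`hodgecm-mathlib-K2E1-p08` (g4); self-dealt continuation of DEAL «EIS-U3-GODEMENT» (K2E1-plan (g3); offers (b)(c) 05:01Z ∕ 05:12Z).  THEOREMS ONLY (no `def`, no `instance`, no notation,
no named-fact hypothesis, no `sorry`); lane `--kind proof --supports stmt-HodgeConjecture-24833 --as helper` (count-neutral).

INPUTS (all ★): R2 = `K2E1BorelEisensteinGodementCMThree` (`Σ_q H(γ̃_q g)^τ < ∞` for `τ > 2` with the locally uniform majorant, this seat + K2E4-p11's E5) and the R4a kit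
`K2E1EisensteinSeriesRegularity` (K2E1-p09: `continuous_tsum_of_locallyUniformMajorant`, `differentiableOn_tsum_param`).  Setting: `L` a CM field, `G = U(J₃)` over `L⁺`
(`quasiSplit L⁺ L c 3 = cmDatum L 3 J₃`, rfl), `φ : G(𝔸) → ℂ` bounded (`‖φ‖ ≤ M`), `f_z = flatSectionU φ z`, `E(φ, z)(g) = eisensteinSeriesU (flatSectionU φ z) g`.
* §1 `rpow_le_rpow_add_rpow` — `h^r ≤ h^{σ₁} + h^{σ₂}` for `0 < h`, `σ₁ ≤ r ≤ σ₂` (the two regimes `h ≥ 1`, `h ≤ 1`); `exists_nhds_summable_majorant_borelHeight_rpow_cm_three` (R2's height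
  majorant at the CM pair, `τ > 2`); **`exists_nhds_uniform_majorant_flatSectionU_cm_three`** — ONE summable `u` with `‖f_z(γ̃_q g)‖ ≤ u q` for all `g` near `g₀` AND all `z` with
  `σ₁ ≤ Re z ≤ σ₂` (`2 < σ₁ ≤ σ₂`).
* §2 **`continuous_eisensteinSeriesU_flatSectionU_cm_three (L) (hz : 2 < z.re) (hφc : Continuous φ) (hφ) : Continuous (fun g => E(φ, z)(g))`**.
* §3 **`continuous_eisensteinSeriesU_flatSectionU_uncurry_cm_three`** — joint continuity of `(z, g) ↦ E(φ, z)(g)` on `{z // 2 < Re z} × G(𝔸)` (`φ` continuous).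
* §4 **`differentiableOn_eisensteinSeriesU_flatSectionU_cm_three (L) (hφ) (g) : DifferentiableOn ℂ (fun z => E(φ, z)(g)) {z | 2 < z.re}`** — HOLOMORPHY IN `z` on Godement's
  half-plane for EVERY bounded `φ` (no continuity needed: each term `z ↦ φ(x) · (H x)^z` is entire, Mathlib `DifferentiableAt.const_cpow`).
[MoeglinWaldspurger1995 II.1.5 Prop. («converges absolutely and uniformly on compacta … holomorphic»); Garrett2018 §2.8, §3.10–3.11; Godement1964 §8.]
HONEST LABEL: HC_CM is proved only modulo the 7 printed citations (2 remaining named inputs: hLiu418 = `stmt-HodgeConjecture-24832`, h413 = `stmt-HodgeConjecture-24833`) until rung 0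
closes; count-neutral helper, proves no printed statement, closes no socket.
-/

set_option autoImplicit false
-- the mandated namespace repeats the single-problem summit's segment (`HodgeConjecture.HodgeConjecture`)
set_option linter.dupNamespace false

noncomputable section

open Set Filter Topology MulAction NumberField
open scoped NNReal
open Literature.NumberTheory.Automorphic Literature.NumberTheory.Automorphic.UnitaryGroup
open Summit.HodgeConjecture.HodgeConjecture.Cruxes.H413.K2E1BorelEisensteinU
open Summit.HodgeConjecture.HodgeConjecture.Cruxes.H413.K2E1BorelEisensteinGodementU3
open Summit.HodgeConjecture.HodgeConjecture.Cruxes.H413.K2E1BorelEisensteinGodementCMThree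
open Summit.HodgeConjecture.HodgeConjecture.Cruxes.H413.K2E1EisensteinSeriesRegularity

namespace Summit.HodgeConjecture.HodgeConjecture.Cruxes.H413.K2E1BorelEisensteinRegularCMThree

/-! ## §1 The `z`-uniform majorant -/

/-- `h^r ≤ h^{σ₁} + h^{σ₂}` for `0 < h` and `σ₁ ≤ r ≤ σ₂` (`h ≥ 1`: `h^r ≤ h^{σ₂}`; `h ≤ 1`: `h^r ≤ h^{σ₁}`). [folklore] -/
theorem rpow_le_rpow_add_rpow {h : ℝ} (hh : 0 < h) {σ₁ σ₂ r : ℝ} (h₁ : σ₁ ≤ r) (h₂ : r ≤ σ₂) : h ^ r ≤ h ^ σ₁ + h ^ σ₂ := by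
  rcases le_total 1 h with h1 | h1
  · exact (Real.rpow_le_rpow_of_exponent_le h1 h₂).trans (le_add_of_nonneg_left (Real.rpow_nonneg hh.le _))
  · exact (Real.rpow_le_rpow_of_exponent_ge hh h1 h₁).trans (le_add_of_nonneg_right (Real.rpow_nonneg hh.le _))

variable (L : Type) [Field L] [NumberField L] [IsCMField L]

/-- **R2's height majorant at the CM pair**: for `τ > 2` every `g₀` has a neighbourhood `U` and a summable `u` with `H(γ̃_q g)^τ ≤ u q` on `U` (★ `exists_nhds_summable_majorant_borelHeight_rpow_three'`
with `[L : L⁺] = 2`, `c² = 1`, `c ≠ 1`, Iwasawa ★ discharged). [cite: MoeglinWaldspurger1995, II.1.5] [cite: Garrett2018, §3.10 (Cor. 3.10.2)] -/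
theorem exists_nhds_summable_majorant_borelHeight_rpow_cm_three {τ : ℝ} (hτ : 2 < τ) (g₀ : (quasiSplit (↥(maximalRealSubfield L)) L (IsCMField.complexConj L) 3).Adelic) :
    ∃ U ∈ 𝓝 g₀, ∃ u : Quotient (orbitRel ↥(borelU ((IsCMField.complexConj L : L ≃ₐ[↥(maximalRealSubfield L)] L) : L →+* L) ((StdForm.antidiagonal 3).over L))
        ↥(unitaryGroupOfForm ((IsCMField.complexConj L : L ≃ₐ[↥(maximalRealSubfield L)] L) : L →+* L) ((StdForm.antidiagonal 3).over L))) → ℝ,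
      Summable u ∧ ∀ g ∈ U, ∀ q,
        ((borelHeight ((quasiSplit (↥(maximalRealSubfield L)) L (IsCMField.complexConj L) 3).toAdelic
          (Quotient.out q : ↥(unitaryGroupOfForm ((IsCMField.complexConj L : L ≃ₐ[↥(maximalRealSubfield L)] L) : L →+* L) ((StdForm.antidiagonal 3).over L))) * g) : ℝ)) ^ τ ≤ u q :=
  exists_nhds_summable_majorant_borelHeight_rpow_three' (Algebra.IsQuadraticExtension.finrank_eq_two (↥(maximalRealSubfield L)) L)
    (AlgEquiv.ext fun x => IsCMField.complexConj_apply_apply L x) (IsCMField.complexConj_ne_one L) (exists_mem_borelAdelic_mul_mem_standardMaximalCompactGL_cm_three L) hτ g₀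

/-- **THE `z`-UNIFORM MAJORANT**: for `2 < σ₁ ≤ σ₂` and `‖φ‖ ≤ M`, every `g₀` has a neighbourhood `U` and ONE summable `u` with `‖f_z(γ̃_q g)‖ ≤ u q` for all `g ∈ U`, all `q`, and ALL `z` with
`σ₁ ≤ Re z ≤ σ₂` (`‖f_z(x)‖ = ‖φ x‖ H(x)^{Re z} ≤ M (H(x)^{σ₁} + H(x)^{σ₂})`). [cite: MoeglinWaldspurger1995, II.1.5] [cite: Garrett2018, §2.8] -/
theorem exists_nhds_uniform_majorant_flatSectionU_cm_three {σ₁ σ₂ : ℝ} (hσ₁ : 2 < σ₁) (hσ : σ₁ ≤ σ₂)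
    {φ : (quasiSplit (↥(maximalRealSubfield L)) L (IsCMField.complexConj L) 3).Adelic → ℂ} {M : ℝ} (hφ : ∀ x, ‖φ x‖ ≤ M)
    (g₀ : (quasiSplit (↥(maximalRealSubfield L)) L (IsCMField.complexConj L) 3).Adelic) :
    ∃ U ∈ 𝓝 g₀, ∃ u : Quotient (orbitRel ↥(borelU ((IsCMField.complexConj L : L ≃ₐ[↥(maximalRealSubfield L)] L) : L →+* L) ((StdForm.antidiagonal 3).over L))
        ↥(unitaryGroupOfForm ((IsCMField.complexConj L : L ≃ₐ[↥(maximalRealSubfield L)] L) : L →+* L) ((StdForm.antidiagonal 3).over L))) → ℝ,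
      Summable u ∧ ∀ g ∈ U, ∀ q, ∀ z : ℂ, σ₁ ≤ z.re → z.re ≤ σ₂ →
        ‖flatSectionU φ z ((quasiSplit (↥(maximalRealSubfield L)) L (IsCMField.complexConj L) 3).toAdelic
          (Quotient.out q : ↥(unitaryGroupOfForm ((IsCMField.complexConj L : L ≃ₐ[↥(maximalRealSubfield L)] L) : L →+* L) ((StdForm.antidiagonal 3).over L))) * g)‖ ≤ u q := by
  obtain ⟨U₁, hU₁, u₁, hu₁, hle₁⟩ := exists_nhds_summable_majorant_borelHeight_rpow_cm_three L hσ₁ g₀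
  obtain ⟨U₂, hU₂, u₂, hu₂, hle₂⟩ := exists_nhds_summable_majorant_borelHeight_rpow_cm_three L (hσ₁.trans_le hσ) g₀
  have hM : 0 ≤ M := (norm_nonneg _).trans (hφ 1)
  refine ⟨U₁ ∩ U₂, inter_mem hU₁ hU₂, fun q => M * (u₁ q + u₂ q), (hu₁.add hu₂).mul_left M, fun g hg q z hz₁ hz₂ => ?_⟩
  rw [norm_flatSectionU]
  refine mul_le_mul (hφ _) ?_ (Real.rpow_nonneg (NNReal.coe_nonneg _) _) hM
  exact (rpow_le_rpow_add_rpow (by exact_mod_cast borelHeight_pos _) hz₁ hz₂).trans (add_le_add (hle₁ g hg.1 q) (hle₂ g hg.2 q))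

/-! ## §2 Continuity in `g` -/

/-- **`g ↦ E(φ, z)(g)` IS CONTINUOUS on `U(J₃)(𝔸_{L⁺})`** for `Re z > 2` and `φ` continuous and bounded (★ p09 `continuous_tsum_translate_left` at ★ `continuous_flatSectionU` and R2's
majorant ★ `exists_locallyUniform_majorant_flatSectionU_cm_three`). [cite: MoeglinWaldspurger1995, II.1.5] [cite: Garrett2018, §2.8] -/
theorem continuous_eisensteinSeriesU_flatSectionU_cm_three {z : ℂ} (hz : 2 < z.re)
    {φ : (quasiSplit (↥(maximalRealSubfield L)) L (IsCMField.complexConj L) 3).Adelic → ℂ} (hφc : Continuous φ) {M : ℝ} (hφ : ∀ x, ‖φ x‖ ≤ M) :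
    Continuous fun g : (quasiSplit (↥(maximalRealSubfield L)) L (IsCMField.complexConj L) 3).Adelic => eisensteinSeriesU (flatSectionU φ z) g :=
  continuous_tsum_translate_left (continuous_flatSectionU hφc z) (exists_locallyUniform_majorant_flatSectionU_cm_three L hz hφ)

/-! ## §3 Joint continuity in `(z, g)` on `{Re z > 2} × G(𝔸)` -/

/-- `(z, x) ↦ f_z(x) = φ(x) · H(x)^z` is jointly continuous (`φ` continuous; complex power of a positive real base). [cite: MoeglinWaldspurger1995, II.1.5] -/
theorem continuous_flatSectionU_uncurry {φ : (quasiSplit (↥(maximalRealSubfield L)) L (IsCMField.complexConj L) 3).Adelic → ℂ} (hφc : Continuous φ) :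
    Continuous fun p : ℂ × (quasiSplit (↥(maximalRealSubfield L)) L (IsCMField.complexConj L) 3).Adelic => flatSectionU φ p.1 p.2 := by
  simp only [flatSectionU_apply]
  refine (hφc.comp continuous_snd).mul ?_
  have hH : Continuous fun p : ℂ × (quasiSplit (↥(maximalRealSubfield L)) L (IsCMField.complexConj L) 3).Adelic => ((borelHeight p.2 : ℝ) : ℂ) :=
    Complex.continuous_ofReal.comp (NNReal.continuous_coe.comp (continuous_borelHeight.comp continuous_snd))
  exact hH.cpow continuous_fst fun p => Or.inl (by rw [Complex.ofReal_re]; exact_mod_cast borelHeight_pos p.2)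

/-- **`(z, g) ↦ E(φ, z)(g)` IS JOINTLY CONTINUOUS ON `{z | 2 < Re z} × U(J₃)(𝔸_{L⁺})`** (typed on the subtype of the half-plane) for `φ` continuous and bounded — §1's `z`-uniform majorant
in ★ p09 `continuous_tsum_of_locallyUniformMajorant`. [cite: MoeglinWaldspurger1995, II.1.5] [cite: Garrett2018, §2.8] -/
theorem continuous_eisensteinSeriesU_flatSectionU_uncurry_cm_three
    {φ : (quasiSplit (↥(maximalRealSubfield L)) L (IsCMField.complexConj L) 3).Adelic → ℂ} (hφc : Continuous φ) {M : ℝ} (hφ : ∀ x, ‖φ x‖ ≤ M) :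
    Continuous fun p : {z : ℂ // 2 < z.re} × (quasiSplit (↥(maximalRealSubfield L)) L (IsCMField.complexConj L) 3).Adelic =>
      eisensteinSeriesU (flatSectionU φ (p.1 : ℂ)) p.2 := by
  refine continuous_tsum_of_locallyUniformMajorant
    (F := fun q (p : {z : ℂ // 2 < z.re} × (quasiSplit (↥(maximalRealSubfield L)) L (IsCMField.complexConj L) 3).Adelic) =>
      flatSectionU φ (p.1 : ℂ) ((quasiSplit (↥(maximalRealSubfield L)) L (IsCMField.complexConj L) 3).toAdelic
        (Quotient.out q : ↥(unitaryGroupOfForm ((IsCMField.complexConj L : L ≃ₐ[↥(maximalRealSubfield L)] L) : L →+* L) ((StdForm.antidiagonal 3).over L))) * p.2))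
    (fun q => (continuous_flatSectionU_uncurry L hφc).comp ((continuous_subtype_val.comp continuous_fst).prodMk (continuous_const.mul continuous_snd))) fun p₀ => ?_
  -- the strip `σ₁ < Re z < σ₂` around `Re z₀` and the `g`-neighbourhood of §1
  set σ₁ : ℝ := (2 + (p₀.1 : ℂ).re) / 2 with hσ₁
  set σ₂ : ℝ := (p₀.1 : ℂ).re + 1 with hσ₂
  have h2σ₁ : 2 < σ₁ := by rw [hσ₁]; linarith [p₀.1.2]
  have hσ₁z : σ₁ < (p₀.1 : ℂ).re := by rw [hσ₁]; linarith [p₀.1.2]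
  have hzσ₂ : (p₀.1 : ℂ).re < σ₂ := by rw [hσ₂]; linarith
  obtain ⟨U, hU, u, hu, hle⟩ := exists_nhds_uniform_majorant_flatSectionU_cm_three L h2σ₁ (hσ₁z.le.trans hzσ₂.le) hφ p₀.2
  have hstrip : {w : {z : ℂ // 2 < z.re} | σ₁ < (w : ℂ).re ∧ (w : ℂ).re < σ₂} ∈ 𝓝 p₀.1 :=
    (isOpen_Ioo.preimage (Complex.continuous_re.comp continuous_subtype_val)).mem_nhds ⟨hσ₁z, hzσ₂⟩
  refine ⟨_, prod_mem_nhds hstrip hU, u, hu, fun p hp q => hle p.2 hp.2 q (p.1 : ℂ) hp.1.1.le hp.1.2.le⟩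

/-! ## §4 Holomorphy in `z` on Godement's half-plane -/

/-- Each term `z ↦ f_z(x) = φ(x) · (H x)^z` is entire (positive real base). [cite: MoeglinWaldspurger1995, II.1.5] -/
theorem differentiable_flatSectionU_apply (φ : (quasiSplit (↥(maximalRealSubfield L)) L (IsCMField.complexConj L) 3).Adelic → ℂ)
    (x : (quasiSplit (↥(maximalRealSubfield L)) L (IsCMField.complexConj L) 3).Adelic) : Differentiable ℂ fun z : ℂ => flatSectionU φ z x := by
  simp only [flatSectionU_apply]
  have hne : ((borelHeight x : ℝ) : ℂ) ≠ 0 := by exact_mod_cast (borelHeight_pos x).ne'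
  exact fun z => (differentiableAt_const _).mul (differentiableAt_id.const_cpow (Or.inl hne))

/-- **`z ↦ E(φ, z)(g)` IS HOLOMORPHIC ON `{z | 2 < Re z}`** for every bounded `φ` and every `g ∈ U(J₃)(𝔸_{L⁺})` — §1's `z`-uniform majorant (at fixed `g`) in ★ p09 `differentiableOn_tsum_param`.
[cite: MoeglinWaldspurger1995, II.1.5] [cite: Garrett2018, §2.8] [cite: Godement1964, §8] -/
theorem differentiableOn_eisensteinSeriesU_flatSectionU_cm_three
    {φ : (quasiSplit (↥(maximalRealSubfield L)) L (IsCMField.complexConj L) 3).Adelic → ℂ} {M : ℝ} (hφ : ∀ x, ‖φ x‖ ≤ M)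
    (g : (quasiSplit (↥(maximalRealSubfield L)) L (IsCMField.complexConj L) 3).Adelic) :
    DifferentiableOn ℂ (fun z : ℂ => eisensteinSeriesU (flatSectionU φ z) g) {z : ℂ | 2 < z.re} := by
  refine differentiableOn_tsum_param (isOpen_lt continuous_const Complex.continuous_re) g
    (F := fun q (z : ℂ) (g : (quasiSplit (↥(maximalRealSubfield L)) L (IsCMField.complexConj L) 3).Adelic) =>
      flatSectionU φ z ((quasiSplit (↥(maximalRealSubfield L)) L (IsCMField.complexConj L) 3).toAdelic
        (Quotient.out q : ↥(unitaryGroupOfForm ((IsCMField.complexConj L : L ≃ₐ[↥(maximalRealSubfield L)] L) : L →+* L) ((StdForm.antidiagonal 3).over L))) * g))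
    (fun q => (differentiable_flatSectionU_apply L φ _).differentiableOn) fun z₀ hz₀ => ?_
  set σ₁ : ℝ := (2 + z₀.re) / 2 with hσ₁
  set σ₂ : ℝ := z₀.re + 1 with hσ₂
  have hz₀' : 2 < z₀.re := hz₀
  have h2σ₁ : 2 < σ₁ := by rw [hσ₁]; linarith
  have hσ₁z : σ₁ < z₀.re := by rw [hσ₁]; linarith
  have hzσ₂ : z₀.re < σ₂ := by rw [hσ₂]; linarith
  obtain ⟨U, hU, u, hu, hle⟩ := exists_nhds_uniform_majorant_flatSectionU_cm_three L h2σ₁ (hσ₁z.le.trans hzσ₂.le) hφ g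
  exact ⟨{w : ℂ | σ₁ < w.re ∧ w.re < σ₂}, (isOpen_Ioo.preimage Complex.continuous_re).mem_nhds ⟨hσ₁z, hzσ₂⟩, u, hu,
    fun w hw q => hle g (mem_of_mem_nhds hU) q w hw.1.le hw.2.le⟩

end Summit.HodgeConjecture.HodgeConjecture.Cruxes.H413.K2E1BorelEisensteinRegularCMThree

end
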